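import Summits.ValiantsHypothesis.ValiantsHypothesis.Theorems.LacunarySymmetroidMatrixDescartesFiniteSectorRealisableNineThree
import Summits.ValiantsHypothesis.ValiantsHypothesis.Theorems.LacunarySymmetroidMatrixDescartesFiniteSectorEtaTwoSix
import Summits.ValiantsHypothesis.ValiantsHypothesis.Theorems.LacunarySymmetroidMatrixDescartesFiniteSectorSigmaKThreeAll
import Summits.ValiantsHypothesis.ValiantsHypothesis.Theorems.LacunarySymmetroidMatrixDescartesFiniteSectorStampCeilingKThreeAll

/-!
# `MatrixDescartes` — line «finite»: the `(9,3)` cell is EXACT on both sides in both currencies: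
# `ν(9,3) = 34` and `η(9,3) = 68` (by name)

HONEST FRAMING.  Object-search cell `pub-symmetroid`, seat val-sym-eng-3 g8 (census/instrument engine #3).  HELPER of
the crux item `stmt-ValiantsHypothesis-18050` (`Theses.LacunarySymmetroid.MatrixDescartes`, asymptotic in `K`) with NO
closure claim — register bookkeeping only, in the pattern of `…FiniteSectorEtaEightThree` (g7).  The seat's witness
`fullyRealisable_nine_016_thirtyfour` (`…FiniteSectorRealisableNineThree`: a symmetric `9 × 9` half-pencil on the
extremal basis `(0,1,6)` — an `8 → 9` EXTENSION of a lifted twin-allowed symmetric tropical design, found by the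
top-down (class-reversed) chain search — with a full-positive-rooted determinant of degree `34`) is read against the
kernel ceilings of the `K = 3` column (closed forms, all `m`):

* stamp currency: `stampLawAt_K_three 9 _ : StampLawAt 9 3 34` (`…FiniteSectorStampCeilingKThreeAll`, Stöhr's ceiling
  `⌊(m²+6m+1)/4⌋`) and, here, `not_stampLawAt_nine_three_33 : ¬ StampLawAt 9 3 33` — so **`ν(9,3) = 34 = n(9,2)`** exactly;
* sector currency: `hypRootLawAt_K_three_all 9 _ : HypRootLawAt 9 3 68` (`…FiniteSectorSigmaKThreeAll`, Conjecture Σ on the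
  `K = 3` column) and, here, `not_hypRootLawAt_nine_three_67 : ¬ HypRootLawAt 9 3 67` by the PROVED doubling `u ↦ u²`
  (door-p5's adapter `not_hypRootLawAt_of_fullyRealisable`, T2: an in-sector `(9,3)` pencil on `(0,2,12)` of degree `68`) —
  so **`η(9,3) = 68 = σ(9,3)`** exactly.

With `(2,3)` (dense), F4, F5, `(5,3)`, `(6,3)`, `(7,3)`, `(8,3)` and this cell the `K = 3` column of the instrument table of
`Cruxes/MatrixDescartes/Lines/finite.md` is exact on both sides, by name, for every `m ≤ 9`.  Nothing here bears on the
crux or on `VP ≠ VNP`.  [folklore] Descartes / postage-stamp bookkeeping; no citation exists or is needed.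
-/

-- `Summit.ValiantsHypothesis.ValiantsHypothesis.…` repeats a component by the D-0017 layout
-- (single-conjunct summit), which the `dupNamespace` linter flags; the name is mandated.
set_option linter.dupNamespace false

namespace Summit.ValiantsHypothesis.ValiantsHypothesis.Theorems.LacunarySymmetroidMatrixDescartes.FiniteSector

/-- **`ν(9,3) = 34` is EXACT: the ceiling `33` fails** (witness `fullyRealisable_nine_016_thirtyfour` on `(0,1,6)`).
[folklore] -/
theorem not_stampLawAt_nine_three_33 : ¬ StampLawAt 9 3 33 := by
  intro h
  obtain ⟨S, hS, hfull, hdeg⟩ := fullyRealisable_nine_016_thirtyfour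
  have := h _ S hS hfull
  omega

/-- **`ν(9,3) = 34` EXACT on both sides** (`n(9,2) = 34`: ceiling `stampLawAt_K_three` at `m = 9`, floor
`not_stampLawAt_nine_three_33`). [folklore] -/
theorem nu_nine_three_exact : StampLawAt 9 3 34 ∧ ¬ StampLawAt 9 3 33 :=
  ⟨stampLawAt_K_three 9 (by norm_num), not_stampLawAt_nine_three_33⟩

/-- **`η(9,3) ≥ 68`**: `¬ HypRootLawAt 9 3 67` — the doubled `(9,3)` realisation
(`fullyRealisable_nine_016_thirtyfour`): an in-sector (all roots real and simple) symmetric `(9,3)` pencil on `(0,2,12)`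
of degree `68` (adapter `not_hypRootLawAt_of_fullyRealisable`, T2). [folklore] -/
theorem not_hypRootLawAt_nine_three_67 : ¬ HypRootLawAt 9 3 67 :=
  not_hypRootLawAt_of_fullyRealisable fullyRealisable_nine_016_thirtyfour (by norm_num)

/-- **`η(9,3) = 68` EXACT on both sides** (`σ(9,3) = 68 = 2·n(9,2)`: ceiling `hypRootLawAt_K_three_all` at `m = 9`, floor
`not_hypRootLawAt_nine_three_67`). [folklore] -/
theorem eta_nine_three_exact : HypRootLawAt 9 3 68 ∧ ¬ HypRootLawAt 9 3 67 :=
  ⟨hypRootLawAt_K_three_all 9 (by norm_num), not_hypRootLawAt_nine_three_67⟩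

end Summit.ValiantsHypothesis.ValiantsHypothesis.Theorems.LacunarySymmetroidMatrixDescartes.FiniteSector
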